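import Summits.BirchSwinnertonDyer.BirchSwinnertonDyer.Theorems.GenusKolyvaginAtTwoGenusDeepSupplyAtTwoNegDiscNarrowKFourCellInvariantClasses
import Summits.BirchSwinnertonDyer.BirchSwinnertonDyer.Theorems.GenusKolyvaginAtTwoGenusPrimitiveSupplyAtTwoPosDiscShallowKFourPosCellCapitulation
import Summits.BirchSwinnertonDyer.BirchSwinnertonDyer.Theorems.GenusKolyvaginAtTwoGenusPrimitiveSupplyAtTwoKolyvaginClassAtTwo
import Summits.BirchSwinnertonDyer.Rank1Residual.X11b.KolyvaginBottomPoint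
import HarnessLib

/-!
# Route `GenusKolyvaginAtTwo`, crux 23491 (Δ<0 supply), K₄ cell at positive depth: THE KUMMER CLASS OF `y_K / 2^{M₀}` DESCENDS TO A
# DISTINGUISHED NON-ZERO CLASS `s_y ∈ Sel₂(E/ℚ)`, AND A DEEP CLASS `c₁(ℓ)` REALISES IT IFF `P(ℓ) ≡ y_K/2^{M₀} (mod 2E(K[ℓ]))`

LEAD seat `bsd-line-gk2-p1` g23 (cell `bsd-f1-sign2`), `--supports stmt-BirchSwinnertonDyer-31526 --as helper` (K₄ = `K4Neg`, the beyond-print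
child of crux 23491).  THEOREMS ONLY (no definition, no named fact, no `sorry`).  **BSD is NOT proved by this file; nothing about Kolyvagin's
conjecture at `2` is asserted; no item is closed.**  This is the Δ<0 twin of gk2-p5 g35's K₄⁺ file
`…GenusPrimitiveSupplyAtTwoPosDiscShallowKFourPosCellCapitulation` (p767715), run on the LEAD g22 descent of the K₄ cell
(`KFourCell.existsUnique_mem_selmerGroup_resTorsion_eq_of_cell`, p766389 — CONDITIONAL on the two print facts hPT (Poitou–Tate duality for
Selmer structures over `ℚ`) and hEP (local Euler–Poincaré characteristic)), plus ONE sign-free addition (§3) not in the K₄⁺ file.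

* §1 (K₄ cell, Δ<0, prime frame `d_K = −ℓ₀`, `2` split, twin `#Sel₂(Wd) = 2`) **`existsUnique_resTorsion_eq_kummer_of_cell_of_eq`** — for a
  Heegner point `P ∈ E(K)` with `w(E) = +1`, `2^M Q₀ = P`, `Q₀ ∉ 2E(K)`: a UNIQUE `s_y ∈ H¹(ℚ, E[2])` has `res_K s_y = κ₂(Q₀)`; `s_y ∈ Sel₂(E/ℚ)`
  and `s_y ≠ 0` (g35's sign-free frame lemmas `KFourPosCell.conjAct_kummerMapTorsion_eq_self_of_frame` / `…kummerMapTorsion_ne_zero_of_frame` + the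
  tree's `kummerMapTorsion_mem_selmerGroup` + p766389).  `res_K s_y` is a Kummer class over `K`, so `s_y` dies in `Ш(E/K)`: it spans the
  capitulation kernel `H¹(Gal(K/ℚ), E(K))` on the cell.  CONDITIONAL (hPT, hEP).
* §2 (cruxes' currency) **`existsUnique_resTorsion_eq_kummer_of_depth_pos_of_cell`** — habitat-type hypotheses, a conductor-`1` datum `d₁`,
  McCallum's normal form `2^{M₀} ∣ P(1)`, `2^{M₀+1} ∤ P(1)` in `E(K[1])`: `P₀, Q₀ ∈ E(K)` with `P₀ ↦ P(1)`, `2^{M₀}Q₀ = P₀`, `Q₀ ∉ 2E(K)` (McCallum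
  Lemma 5.1 both ways, as in g35 §3) and the class `s_y`.  CONDITIONAL (hPT, hEP).
* §3 (SIGN-FREE, UNCONDITIONAL, new) **`kolyvaginClass_two_eq_kummerMapTorsion_iff`** — for `K` imaginary quadratic with odd `d_K ≠ −3` and the
  Heegner hypothesis, `ρ̄_{E,2}` onto, a Kolyvagin prime `ℓ` at `2`, data `d₁` (conductor `1`), `d` (conductor `ℓ`), and ANY `Q₀ ∈ E(K)`:
  **`c₁(ℓ) = κ₂(Q₀)` in `H¹(K, E[2])` iff `P(ℓ) − Q₀ ∈ 2E(K[ℓ])`** (McCallum's cocycle is additive, is the Kummer cocycle on `E(K)`, and vanishes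
  iff its point is `2`-divisible in `E(K[ℓ])` — Cor. 4.5 both ways at `2`, admissibility at `2` from `GenusKoly.isAdmissible_pointsSubgroup_two`).
* §4 (READING, K₄ cell) **`kolyvaginClass_two_trichotomy_of_cell`** — at a Kolyvagin prime `ℓ` with `c₁(ℓ)` Selmer at `λ ∣ ℓ` (`hlam`: the route
  item Q2, itself a tree theorem modulo the print fact 23091, gk2-p2 g7 `GenusExact.kolyvaginRelationAtTwo_of_frobeniusCongruence`): the unique
  descent `s(ℓ) ∈ Sel₂(E/ℚ)` of `c₁(ℓ)` (p767174 §4) satisfies `s(ℓ) = 0 ⟺ P(ℓ) ∈ 2E(K[ℓ])` and `s(ℓ) = s_y ⟺ P(ℓ) − Q₀ ∈ 2E(K[ℓ])`.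
  So the positive-depth kernel K₄ at a single deep prime asks for a deep `ℓ` with `P(ℓ) ∉ 2E(K[ℓ])`; such a class is EITHER the capitulating
  class `s_y` (`P(ℓ) ≡ y_K/2^{M₀}`) OR one of the two classes of `Sel₂(E/ℚ) ≅ Ш(E/ℚ)[2]` that survive in `Ш(E/K)[2]`.

References: [GrossLMS1991] §4 (4.1), (4.4), Prop. 4.7, §5 Prop. 5.3, (5.1), §11; [McCallumLMS1991] §4 (4)–(6), Cor. 4.5, §5 Lemma 5.1;
[Kramer1981] Thm. 1; [SilvermanAEC2009] VIII.§2, Thm. X.4.2.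
-/

set_option linter.dupNamespace false -- `Summit.<P>.<Sub>` repeats `BirchSwinnertonDyer` (D-0017)
set_option autoImplicit false

noncomputable section

open scoped Classical NumberField

namespace Summit.BirchSwinnertonDyer.BirchSwinnertonDyer.Theorems.GenusSupplyNarrow.KFourCell

open WeierstrassCurve NumberField IsDedekindDomain Field Function
open Literature.NumberTheory.EllipticCurves Literature.NumberTheory.GaloisRepresentations
open Literature.NumberTheory.GaloisCohomology Literature.NumberTheory.EllipticCurves.ModularForms
open Literature.NumberTheory.EllipticCurves.KolyvaginCocycle
open Summit.BirchSwinnertonDyer.BirchSwinnertonDyer.Theorems.GenusSupplyNarrow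
open Summit.BirchSwinnertonDyer.Rank1Residual.X11b

/-! ## §1 On the K₄ cell (Δ<0): the distinguished class `s_y ∈ Sel₂(E/ℚ)` -/

section Cell

variable (W : WeierstrassCurve ℚ) [W.IsElliptic] [W.IsGloballyMinimal] (K : Type) [Field K] [NumberField K]

/-- **THE KUMMER CLASS OF `Q₀ = P/2^M` DESCENDS TO A UNIQUE NON-ZERO `s_y ∈ Sel₂(E/ℚ)` ON THE K₄ CELL** (Δ<0 twin of g35's
`KFourPosCell.existsUnique_resTorsion_eq_kummer_of_kFourPos`, at a general exponent `e = 2` for bookkeeping).  Cell: `W/ℚ` globally minimal, `Δ < 0`,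
`ρ̄_{E,2}` onto, `#Sel₂(E) = 4`; `K` imaginary quadratic with `d_K = −ℓ₀` (`ℓ₀` prime) odd, Heegner for `N_E`, `2` split; `Wd ≅ E^{(d_K)}` elliptic with
`#Sel₂(Wd) = 2`; `σ₀ ≠ 1` in `Aut(K/ℚ)`; `P ∈ E(K)` Heegner, `w(E) = +1`, `2^M Q₀ = P`, `Q₀ ∉ 2E(K)`.  Then **there is a unique `s_y ∈ H¹(ℚ, E[2])`
with `res_K s_y = κ₂(Q₀)`; it lies in `Sel₂(E/ℚ)`; and every such `s_y` is `≠ 0`.**  CONDITIONAL on hPT/hEP (through p766389).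
[cite: Kramer1981, Thm. 1] [cite: GrossLMS1991, §5 (5.1), Prop. 5.3] [cite: SilvermanAEC2009, Thm. X.4.2(a)] -/
theorem existsUnique_resTorsion_eq_kummer_of_cell_of_eq [NeZero (W.conductorNorm ℤ)]
    (hPT : poitouTate_selmerStructure_duality_real ℚ)
    (hEP : ∀ v : HeightOneSpectrum (𝓞 ℚ), localEulerPoincareCharacteristic (v.adicCompletion ℚ))
    (hΔ : W.Δ < 0) (hs2 : W.HasSurjectiveModNGaloisRep 2) (h4 : Nat.card (W.selmerGroup 2) = 4)
    (hK : IsImaginaryQuadratic K) (hodd : Odd (discr K)) (hH : SatisfiesHeegnerHypothesis (W.conductorNorm ℤ) K)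
    (h2K : ((Ideal.span {(2 : ℤ)}).primesOver (𝓞 K)).ncard = 2)
    {ℓ₀ : ℕ} [Fact ℓ₀.Prime] (hd : discr K = -(ℓ₀ : ℤ))
    (Wd : WeierstrassCurve ℚ) [Wd.IsElliptic] (hWd : ∃ C : VariableChange ℚ, C • W.quadraticTwist (discr K : ℚ) = Wd)
    (hSel : Nat.card (Wd.selmerGroup 2) = 2) {σ₀ : K ≃ₐ[ℚ] K} (hσ₀ : σ₀ ≠ 1)
    {P : (W.baseChange K).toAffine.Point} (hP : IsHeegnerPoint (W.conductorNorm ℤ) W K P) (hw1 : W.rootNumber = 1)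
    {M : ℕ} {Q₀ : (W.baseChange K).toAffine.Point} (hQ₀ : ((2 ^ M : ℕ) : ℤ) • Q₀ = P)
    (hndiv : ¬ ∃ R : (W.baseChange K).toAffine.Point, (2 : ℤ) • R = Q₀)
    {e : ℤ} (he : e = ((2 : ℕ) : ℤ))
    (hdiv : ∀ X : geomPoints (W.baseChange K), ∃ Y : geomPoints (W.baseChange K), e • Y = X) :
    (∃! s : galH1Torsion W e, resTorsion W K e s = kummerMapTorsion (W.baseChange K) e hdiv Q₀ ∧ s ∈ W.selmerGroup e) ∧
      ∀ s : galH1Torsion W e, resTorsion W K e s = kummerMapTorsion (W.baseChange K) e hdiv Q₀ → s ≠ 0 := by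
  subst he
  have h2 : Module.finrank ℚ K = 2 := hK.1
  have hL := KFourPosCell.forall_two_smul_eq_zero_baseChange_of_kFourPos W K hs2 h2
  have hL' : ∀ T : (W.baseChange K).toAffine.Point, (2 : ℤ) • T = 0 → T = 0 := fun T hT ↦ hL T (by simpa using hT)
  have hfix := KFourPosCell.conjAct_kummerMapTorsion_eq_self_of_frame W K hK hH hP hw1 hL' hσ₀ hQ₀
  have hSelK := (W.baseChange K).kummerMapTorsion_mem_selmerGroup ((2 : ℕ) : ℤ) (GenusKolyArch.hdiv_two_baseChange W K) Q₀
  have hne := KFourPosCell.kummerMapTorsion_ne_zero_of_frame W K hndiv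
  refine ⟨existsUnique_mem_selmerGroup_resTorsion_eq_of_cell W K hPT hEP hΔ h4 hK hodd hH h2K hd Wd hWd hSel hL hσ₀ hSelK hfix,
    fun s hs h0 ↦ hne ?_⟩
  rw [← hs, h0, map_zero]

/-! ## §2 In the cruxes' currency: `Q₀ = y_K/2^{M₀}` at McCallum's exponent -/

/-- **ON THE K₄ CELL OF CRUX 23491, AT McCALLUM'S EXPONENT `M₀`, THE CLASS OF `y_K/2^{M₀}` IS A DISTINGUISHED NON-ZERO ELEMENT OF `Sel₂(E/ℚ)`.**
Habitat-type hypotheses: `r_an(E) = 0`, `ρ̄_{E,2}` onto, `d_K·Δ_E ∉ ℚ²`, `Δ < 0`, `#Sel₂(E) = 4`; `K` imaginary quadratic, `d_K = −ℓ₀` odd,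
Heegner, `2` split, `σ₀ ≠ 1`; `Wd ≅ E^{(d_K)}` with `#Sel₂(Wd) = 2`; a conductor-`1` datum `d₁` and McCallum's normal form `2^{M₀} ∣ P(1)`,
`2^{M₀+1} ∤ P(1)` in `E(K[1])`.  Then there are `P₀, Q₀ ∈ E(K)` with `P₀ ↦ P(1)` Heegner, `2^{M₀}Q₀ = P₀`, `Q₀ ∉ 2E(K)` (McCallum 5.1 both ways),
and a UNIQUE `s_y ∈ H¹(ℚ, E[2])` with `res_K s_y = κ₂(Q₀)`, `s_y ∈ Sel₂(E/ℚ)`, `s_y ≠ 0` — at the syntactic exponent `2 ^ 1` of Kolyvagin's classes.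
READING: the Mordell–Weil line of `E(K)` occupies ONE of the three non-zero classes of `Sel₂(E/ℚ) ≅ Ш(E/ℚ)[2]` on the K₄ cell (§4).
CONDITIONAL on hPT/hEP.  BSD is NOT proved by this. [cite: GrossLMS1991, §4 (4.1), §5 Prop. 5.3] [cite: McCallumLMS1991, §5 Lemma 5.1]
[cite: Kramer1981, Thm. 1] [cite: SilvermanAEC2009, Thm. X.4.2(a)] -/
theorem existsUnique_resTorsion_eq_kummer_of_depth_pos_of_cell [NeZero (W.conductorNorm ℤ)]
    (hPT : poitouTate_selmerStructure_duality_real ℚ)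
    (hEP : ∀ v : HeightOneSpectrum (𝓞 ℚ), localEulerPoincareCharacteristic (v.adicCompletion ℚ))
    (hΔ : W.Δ < 0) (hs2 : W.HasSurjectiveModNGaloisRep 2) (h4 : Nat.card (W.selmerGroup 2) = 4)
    (hK : IsImaginaryQuadratic K) (hodd : Odd (discr K)) (hH : SatisfiesHeegnerHypothesis (W.conductorNorm ℤ) K)
    (h2K : ((Ideal.span {(2 : ℤ)}).primesOver (𝓞 K)).ncard = 2)
    {ℓ₀ : ℕ} [Fact ℓ₀.Prime] (hd : discr K = -(ℓ₀ : ℤ))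
    (Wd : WeierstrassCurve ℚ) [Wd.IsElliptic] (hWd : ∃ C : VariableChange ℚ, C • W.quadraticTwist (discr K : ℚ) = Wd)
    (hSel : Nat.card (Wd.selmerGroup 2) = 2) {σ₀ : K ≃ₐ[ℚ] K} (hσ₀ : σ₀ ≠ 1)
    (hr0 : W.analyticRank = 0) (hsq : ¬ IsSquare ((NumberField.discr K : ℚ) * W.Δ))
    (Dt : ModularParametrizationData W (W.conductorNorm ℤ)) (β : ℤ) (ι : K →+* ℂ) (d₁ : KolyvaginHeegnerData Dt β ι 1)
    {M₀ : ℕ} (hdiv : ∃ Q : (W.baseChange (ringClassField K ι 1)).toAffine.Point, ((2 ^ M₀ : ℕ) : ℤ) • Q = d₁.derivedPoint)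
    (hndiv : ¬ ∃ Q : (W.baseChange (ringClassField K ι 1)).toAffine.Point, ((2 ^ (M₀ + 1) : ℕ) : ℤ) • Q = d₁.derivedPoint)
    (hdiv₂ : ∀ X : geomPoints (W.baseChange K), ∃ Y : geomPoints (W.baseChange K), ((2 ^ 1 : ℕ) : ℤ) • Y = X) :
    ∃ P₀ Q₀ : (W.baseChange K).toAffine.Point, IsHeegnerPoint (W.conductorNorm ℤ) W K P₀ ∧
      Affine.Point.map (W' := W) (algebraMap K (ringClassField K ι 1)).toRatAlgHom P₀ = d₁.derivedPoint ∧
      ((2 ^ M₀ : ℕ) : ℤ) • Q₀ = P₀ ∧ (¬ ∃ R : (W.baseChange K).toAffine.Point, (2 : ℤ) • R = Q₀) ∧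
      (∃! s : galH1Torsion W ((2 ^ 1 : ℕ) : ℤ),
        resTorsion W K ((2 ^ 1 : ℕ) : ℤ) s = kummerMapTorsion (W.baseChange K) ((2 ^ 1 : ℕ) : ℤ) hdiv₂ Q₀ ∧
          s ∈ W.selmerGroup ((2 ^ 1 : ℕ) : ℤ)) ∧
      ∀ s : galH1Torsion W ((2 ^ 1 : ℕ) : ℤ),
        resTorsion W K ((2 ^ 1 : ℕ) : ℤ) s = kummerMapTorsion (W.baseChange K) ((2 ^ 1 : ℕ) : ℤ) hdiv₂ Q₀ → s ≠ 0 := by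
  -- `E(K[1])[2] = 0`
  have htors : ∀ T : (W.baseChange (ringClassField K ι 1)).toAffine.Point, (2 : ℤ) • T = 0 → T = 0 := by
    intro T hT
    have h := GenusExact.torsionBy_two_ringClassField_eq_bot W hK ι one_ne_zero hs2 hsq
    have hT' : T ∈ AddSubgroup.torsionBy (W.baseChange (ringClassField K ι 1)).toAffine.Point ((2 : ℕ) : ℤ) :=
      (Submodule.mem_torsionBy_iff _ T).mpr (by exact_mod_cast hT)
    rw [h] at hT'
    exact (AddSubgroup.mem_bot).mp hT'
  -- the Heegner point `P₀ ∈ E(K)` under `P(1)`, `w(E) = +1`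
  obtain ⟨P₀, hP₀H, hP₀⟩ := heegnerSystem_exists_isHeegnerPoint_map_eq_derivedPoint_one
    (heegnerPointOfConductor_one_galoisConj_holds (W.conductorNorm ℤ) W K) hK hH d₁
  have hw1 : W.rootNumber = 1 := W.rootNumber_eq_one_of_even_analyticRank (by rw [hr0]; exact Even.zero)
  -- McCallum 5.1: `2^{M₀} ∣ y_K` in `E(K)`, `2^{M₀+1} ∤ y_K` in `E(K)`
  have hdivK : ∃ Q₀ : (W.baseChange K).toAffine.Point, ((2 ^ M₀ : ℕ) : ℤ) • Q₀ = P₀ := by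
    obtain ⟨Q, hQ⟩ := hdiv
    obtain ⟨Q₀, hQ₀⟩ := (McCallum1991.exists_pow_smul_eq_derivedPoint_one_iff hK d₁ (p := 2) htors hP₀ M₀).mp
      ⟨Q, by simpa only [Nat.cast_pow, Nat.cast_ofNat] using hQ⟩
    exact ⟨Q₀, by simpa only [Nat.cast_pow, Nat.cast_ofNat] using hQ₀⟩
  have hndivK : ¬ ∃ Q₁ : (W.baseChange K).toAffine.Point, ((2 ^ (M₀ + 1) : ℕ) : ℤ) • Q₁ = P₀ := by
    rintro ⟨Q₁, hQ₁⟩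
    refine hndiv ?_
    obtain ⟨Q, hQ⟩ := (McCallum1991.exists_pow_smul_eq_derivedPoint_one_iff hK d₁ (p := 2) htors hP₀ (M₀ + 1)).mpr
      ⟨Q₁, by simpa only [Nat.cast_pow, Nat.cast_ofNat] using hQ₁⟩
    exact ⟨Q, by simpa only [Nat.cast_pow, Nat.cast_ofNat] using hQ⟩
  obtain ⟨Q₀, hQ₀⟩ := hdivK
  have hQ₀ndiv : ¬ ∃ R : (W.baseChange K).toAffine.Point, (2 : ℤ) • R = Q₀ := by
    rintro ⟨R, hR⟩
    refine hndivK ⟨R, ?_⟩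
    have h22 : ((2 ^ (M₀ + 1) : ℕ) : ℤ) = ((2 ^ M₀ : ℕ) : ℤ) * 2 := by push_cast; ring
    rw [h22, mul_smul, hR, hQ₀]
  exact ⟨P₀, Q₀, hP₀H, hP₀, hQ₀, hQ₀ndiv,
    existsUnique_resTorsion_eq_kummer_of_cell_of_eq W K hPT hEP hΔ hs2 h4 hK hodd hH h2K hd Wd hWd hSel hσ₀ hP₀H hw1 hQ₀ hQ₀ndiv
      (by norm_num) hdiv₂⟩

end Cell

/-! ## §3 SIGN-FREE: a deep class realises the Kummer class of a rational point iff the points agree modulo `2E(K[ℓ])` -/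

section Realise

-- `K : Type`: the tree's ring-class class field theory is universe `0`.
variable {W : WeierstrassCurve ℚ} [W.IsElliptic] [W.IsGloballyMinimal] [NeZero (W.conductorNorm ℤ)]
  {K : Type} [Field K] [NumberField K]
  {Dt : ModularParametrizationData W (W.conductorNorm ℤ)} {β : ℤ} {ι : K →+* ℂ}

/-- **`c₁(ℓ) = κ₂(Q₀)` in `H¹(K, E[2])` iff `P(ℓ) − Q₀ ∈ 2E(K[ℓ])`** — for `W/ℚ` globally minimal with `ρ̄_{E,2}` onto, `K` imaginary quadratic
with odd `d_K ≠ −3` and the Heegner hypothesis, a Kolyvagin prime `ℓ` at `2`, Kolyvagin–Heegner data `d₁` (conductor `1`) and `d` (conductor `ℓ`),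
and ANY `Q₀ ∈ E(K)` (pushed to `E(K[ℓ])` along `K ⊆ K[ℓ]`).  McCallum's cocycle is ADDITIVE in the point (`KolyvaginCocycle.cls_add`), is the Kummer
cocycle on the `Γ_K`-fixed point `Q₀` (`kolyvaginClass_toGeomPoints`), and the class of `P(ℓ) − Q₀` (relative to `E(K[ℓ]) ⊆ E(K̄)`) vanishes iff
`P(ℓ) − Q₀ ∈ 2E(K[ℓ])` (Cor. 4.5 both ways: `kolyvaginClass_eq_zero_iff` with Galois descent to `K[ℓ]`); the standing inputs are DISCHARGED at
`p = 2` (`GenusKoly.isAdmissible_pointsSubgroup_two`, `KolyCert.toGeomPoints_derivedPoint_mem_invPoints_of_dvd_zhang`).  SIGN-FREE, UNCONDITIONAL.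
[cite: McCallumLMS1991, §4 (4)–(6), Cor. 4.5] [cite: GrossLMS1991, Prop. 3.6, §4 (4.4), Prop. 4.7 (1), Lemma 4.3] -/
theorem kolyvaginClass_two_eq_kummerMapTorsion_iff (hK : IsImaginaryQuadratic K) (hodd : Odd (NumberField.discr K))
    (h3 : NumberField.discr K ≠ -3) (hH : SatisfiesHeegnerHypothesis (W.conductorNorm ℤ) K)
    (hsurj : W.HasSurjectiveModNGaloisRep ((2 : ℤ) ^ 1)) {ℓ : ℕ} (hKoly : Zhang2014.IsKolyvaginPrime (W.conductorNorm ℤ) W K 2 ℓ)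
    (d₁ : KolyvaginHeegnerData Dt β ι 1) (d : KolyvaginHeegnerData Dt β ι ℓ)
    (hdiv : ∀ X : geomPoints (W.baseChange K), ∃ Y : geomPoints (W.baseChange K), ((2 ^ 1 : ℕ) : ℤ) • Y = X)
    (Q₀ : (W.baseChange K).toAffine.Point) :
    d.kolyvaginClass Nat.prime_two 1 = kummerMapTorsion (W.baseChange K) ((2 ^ 1 : ℕ) : ℤ) hdiv Q₀ ↔
      ∃ B : (W.baseChange (ringClassField K ι ℓ)).toAffine.Point,
        ((2 ^ 1 : ℕ) : ℤ) • B = d.derivedPoint - Affine.Point.map (W' := W) (algebraMap K (ringClassField K ι ℓ)).toRatAlgHom Q₀ := by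
  have hℓ : ℓ.Prime := hKoly.1
  -- the crux's two data as a family over the divisors `{1, ℓ}` of `ℓ`
  let fam : (m : ℕ) → m ∣ ℓ → KolyvaginHeegnerData Dt β ι m := fun m hm ↦
    if h : m = ℓ then h ▸ d else ((Nat.dvd_prime hℓ).mp hm).resolve_right h ▸ d₁
  have hfam : fam ℓ dvd_rfl = d := by simp [fam]
  have hkol : ∀ q ∈ ℓ.primeFactors, Zhang2014.IsKolyvaginPrime (W.conductorNorm ℤ) W K 2 q ∧ 1 ≤ Zhang2014.kolyvaginIndex W 2 q := by
    intro q hq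
    rw [hℓ.primeFactors, Finset.mem_singleton] at hq
    subst hq
    exact ⟨hKoly, hKoly.2.2.2.2.2⟩
  -- the standing inputs at `p = 2`
  have hA : IsAdmissible (absoluteGaloisGroup K) d.pointsSubgroup ((2 ^ 1 : ℕ) : ℤ) :=
    GenusKoly.isAdmissible_pointsSubgroup_two hK hodd hH hsurj hℓ.ne_zero d 1
  have hP : d.toGeomPoints d.derivedPoint ∈ invPoints (absoluteGaloisGroup K) d.pointsSubgroup ((2 ^ 1 : ℕ) : ℤ) := by
    have h := Three.KolyCert.toGeomPoints_derivedPoint_mem_invPoints_of_dvd_zhang hK ι Dt Nat.prime_two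
      (GenusKoly.heegner_isCoprime_conductorNorm_discr hK hH) (GenusKoly.discr_lt_neg_four_of_odd hK hodd h3) hℓ.squarefree hkol fam ℓ dvd_rfl
    rwa [hfam] at h
  -- `Q₀` pushed to `E(K[ℓ])` and to `E(K̄)`
  set Qℓ : (W.baseChange (ringClassField K ι ℓ)).toAffine.Point :=
    Affine.Point.map (W' := W) (algebraMap K (ringClassField K ι ℓ)).toRatAlgHom Q₀ with hQℓ
  have hQgeom : d.toGeomPoints Qℓ = toGeomPoints (W.baseChange K) Q₀ := KolyvaginBottom.toGeomPoints_map_algebraMap d Q₀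
  have hQfix : ∀ g : absoluteGaloisGroup K, g • toGeomPoints (W.baseChange K) Q₀ = toGeomPoints (W.baseChange K) Q₀ :=
    fun g ↦ smul_toGeomPoints (W.baseChange K) g Q₀
  have hQA : toGeomPoints (W.baseChange K) Q₀ ∈ d.pointsSubgroup := ⟨Qℓ, hQgeom⟩
  have hQinv : toGeomPoints (W.baseChange K) Q₀ ∈ invPoints (absoluteGaloisGroup K) d.pointsSubgroup ((2 ^ 1 : ℕ) : ℤ) :=
    mem_invPoints_of_fixed hQA hQfix
  -- the difference `D = P(ℓ) − Q₀` in `E(K̄)`, an element of `invPoints`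
  have hDinv : d.toGeomPoints d.derivedPoint - toGeomPoints (W.baseChange K) Q₀ ∈
      invPoints (absoluteGaloisGroup K) d.pointsSubgroup ((2 ^ 1 : ℕ) : ℤ) :=
    (invPoints (absoluteGaloisGroup K) d.pointsSubgroup ((2 ^ 1 : ℕ) : ℤ)).sub_mem hP hQinv
  -- roots, and McCallum's cocycle classes: `c(P) = c(D) + c(Q₀)` and `c(Q₀) = κ₂(Q₀)`
  obtain ⟨R, hR⟩ := hdiv (d.toGeomPoints d.derivedPoint)
  obtain ⟨S, hS⟩ := hdiv (toGeomPoints (W.baseChange K) Q₀)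
  have hRS : ((2 ^ 1 : ℕ) : ℤ) • (R - S) = d.toGeomPoints d.derivedPoint - toGeomPoints (W.baseChange K) Q₀ := by
    rw [zsmul_sub, hR, hS]
  have hsum_mem : d.toGeomPoints d.derivedPoint - toGeomPoints (W.baseChange K) Q₀ + toGeomPoints (W.baseChange K) Q₀ ∈
      invPoints (absoluteGaloisGroup K) d.pointsSubgroup ((2 ^ 1 : ℕ) : ℤ) := by
    rw [sub_add_cancel]; exact hP
  have hsum_root : ((2 ^ 1 : ℕ) : ℤ) • (R - S + S) =
      d.toGeomPoints d.derivedPoint - toGeomPoints (W.baseChange K) Q₀ + toGeomPoints (W.baseChange K) Q₀ := by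
    rw [sub_add_cancel, sub_add_cancel, hR]
  rw [d.kolyvaginClass_of_admissible Nat.prime_two 1 hA hP, kolyvaginClass_eq_cls hA hP hR,
    ← kolyvaginClass_toGeomPoints (hdiv := hdiv) hA Q₀ hQinv, kolyvaginClass_eq_cls hA hQinv hS]
  have ha : cls hA (continuous_smul_geomPoints (W.baseChange K)) hP hR =
      cls hA (continuous_smul_geomPoints (W.baseChange K)) hsum_mem hsum_root :=
    cls_congr hA _ (sub_add_cancel _ _).symm (sub_add_cancel _ _).symm
  rw [ha, cls_add hA _ hDinv hQinv hRS hS hsum_mem hsum_root, add_eq_right,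
    cls_eq_zero_iff hA _ hDinv hRS
      (N := {g : absoluteGaloisGroup K | ∀ x : ringClassField K ι ℓ,
        (show AlgebraicClosure K ≃ₐ[K] AlgebraicClosure K from g) (d.emb x) = d.emb x})
      (fun g hg ↦ by rw [smul_sub, Three.KolyCert.smul_toGeomPoints_of_forall_emb d g hg _, hQfix])
      (fun v hv ↦ Three.KolyCert.mem_pointsSubgroup_of_forall_smul_eq d v fun g hg ↦ hv g hg)]
  constructor
  · rintro ⟨_, ⟨B, rfl⟩, hB⟩
    refine ⟨B, Affine.Point.map_injective (W' := W) d.emb.toRatAlgHom ?_⟩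
    change d.toGeomPoints (((2 ^ 1 : ℕ) : ℤ) • B) = d.toGeomPoints (d.derivedPoint - Qℓ)
    rw [map_zsmul, hB, map_sub, hQgeom]
  · rintro ⟨B, hB⟩
    refine ⟨d.toGeomPoints B, ⟨B, rfl⟩, ?_⟩
    rw [← map_zsmul, hB, map_sub, hQgeom]

end Realise

/-! ## §4 READING: the descents `s(ℓ)` of `c₁(ℓ)` and `s_y` of `κ₂(y_K/2^{M₀})` compared — `s(ℓ) = s_y ⟺ P(ℓ) ≡ Q₀ (mod 2E(K[ℓ]))` -/

section Trichotomy

variable (W : WeierstrassCurve ℚ) [W.IsElliptic] [W.IsGloballyMinimal] [NeZero (W.conductorNorm ℤ)]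
  (K : Type) [Field K] [NumberField K]
  {Dt : ModularParametrizationData W (W.conductorNorm ℤ)} {β : ℤ} {ι : K →+* ℂ}

/-- **THE TRICHOTOMY OF A DEEP CLASS, point side (SIGN-FREE, UNCONDITIONAL).**  `W/ℚ` globally minimal with `ρ̄_{E,2}` onto, `K` imaginary quadratic
with odd `d_K ≠ −3` and the Heegner hypothesis, a Kolyvagin prime `ℓ` at `2`, data `d₁` (conductor `1`) and `d` (conductor `ℓ`), `Q₀ ∈ E(K)`.
For ANY `s, s_y ∈ H¹(ℚ, E[2])` with `res_K s = c₁(ℓ)` and `res_K s_y = κ₂(Q₀)` (on the K₄ / K₄⁺ cells: the unique Selmer descents of p767174 §4 /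
its K₄⁺ port and of §2 / g35 p767715): **`s = 0 ⟺ P(ℓ) ∈ 2E(K[ℓ])`** and **`s = s_y ⟺ P(ℓ) − Q₀ ∈ 2E(K[ℓ])`** — `res_K` is injective
(`E(K)[2] = 0` from `ρ̄_{E,2}` onto; `GenusExact.EigenClassesFinite.resTorsion_injective_of_noTorsion`), McCallum Cor. 4.5 at `2`
(`GenusKoly.kolyvaginClass_two_ne_zero_iff_not_two_dvd_prime`) and §3.  READING for K₄ = `K4Neg` (and K₄⁺): with `Q₀ = y_K/2^{M₀}`, a deep prime
`ℓ` witnesses the kernel (`P(ℓ) ∉ 2E(K[ℓ])`, i.e. `s(ℓ) ≠ 0`) EITHER through the capitulating class (`s(ℓ) = s_y`: `P(ℓ) ≡ y_K/2^{M₀}`) OR through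
one of the two remaining classes of `Sel₂(E/ℚ) ≅ Ш(E/ℚ)[2] ≅ (ℤ/2)²`, which survive in `Ш(E/K)[2]`.  BSD is NOT proved by this.
[cite: McCallumLMS1991, §4 Cor. 4.5] [cite: GrossLMS1991, §4 (4.4), Prop. 4.7 (1), §5 (5.1), §11] [cite: Kramer1981, Thm. 1] -/
theorem descent_eq_zero_iff_and_eq_kummer_descent_iff (hK : IsImaginaryQuadratic K) (hodd : Odd (NumberField.discr K))
    (h3 : NumberField.discr K ≠ -3) (hH : SatisfiesHeegnerHypothesis (W.conductorNorm ℤ) K)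
    (hs2 : W.HasSurjectiveModNGaloisRep 2) {ℓ : ℕ} (hKoly : Zhang2014.IsKolyvaginPrime (W.conductorNorm ℤ) W K 2 ℓ)
    (d₁ : KolyvaginHeegnerData Dt β ι 1) (d : KolyvaginHeegnerData Dt β ι ℓ)
    (hdiv : ∀ X : geomPoints (W.baseChange K), ∃ Y : geomPoints (W.baseChange K), ((2 ^ 1 : ℕ) : ℤ) • Y = X)
    (Q₀ : (W.baseChange K).toAffine.Point) {s sy : galH1Torsion W ((2 ^ 1 : ℕ) : ℤ)}
    (hs : resTorsion W K ((2 ^ 1 : ℕ) : ℤ) s = d.kolyvaginClass Nat.prime_two 1)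
    (hsy : resTorsion W K ((2 ^ 1 : ℕ) : ℤ) sy = kummerMapTorsion (W.baseChange K) ((2 ^ 1 : ℕ) : ℤ) hdiv Q₀) :
    (s = 0 ↔ ∃ B : (W.baseChange (ringClassField K ι ℓ)).toAffine.Point, (2 : ℤ) • B = d.derivedPoint) ∧
      (s = sy ↔ ∃ B : (W.baseChange (ringClassField K ι ℓ)).toAffine.Point,
        ((2 ^ 1 : ℕ) : ℤ) • B = d.derivedPoint - Affine.Point.map (W' := W) (algebraMap K (ringClassField K ι ℓ)).toRatAlgHom Q₀) := by
  have h2 : Module.finrank ℚ K = 2 := hK.1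
  have hsurj : W.HasSurjectiveModNGaloisRep ((2 : ℤ) ^ 1) := by rw [pow_one]; exact hs2
  -- `res_K` is injective on `H¹(ℚ, E[2])` (`E(K)[2] = 0`)
  have hL := KFourPosCell.forall_two_smul_eq_zero_baseChange_of_kFourPos W K hs2 h2
  have hL' : ∀ P : (W.baseChange K).toAffine.Point, ((2 ^ 1 : ℕ) : ℤ) • P = 0 → P = 0 :=
    fun P hP ↦ hL P (by simpa using hP)
  obtain ⟨θ, hθ, hc⟩ := Literature.NumberTheory.EllipticCurves.exists_sq_eq_discr_not_mem_range K h2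
  have hinj := GenusExact.EigenClassesFinite.resTorsion_injective_of_noTorsion W K h2 hθ hc ((2 ^ 1 : ℕ) : ℤ) hL'
  refine ⟨?_, ?_⟩
  · -- `s = 0 ⟺ c₁(ℓ) = 0 ⟺ P(ℓ) ∈ 2E(K[ℓ])`
    have hne := GenusKoly.kolyvaginClass_two_ne_zero_iff_not_two_dvd_prime hK hodd h3 hH hsurj hKoly d₁ d
    constructor
    · intro h0
      by_contra hB
      exact (hne.mpr hB) (by rw [← hs, h0, map_zero])
    · intro hB
      apply hinj
      rw [map_zero, hs]
      by_contra hc0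
      exact (hne.mp hc0) hB
  · -- `s = s_y ⟺ c₁(ℓ) = κ₂(Q₀) ⟺ P(ℓ) − Q₀ ∈ 2E(K[ℓ])` (§3)
    rw [← kolyvaginClass_two_eq_kummerMapTorsion_iff hK hodd h3 hH hsurj hKoly d₁ d hdiv Q₀, ← hs, ← hsy]
    exact ⟨fun h ↦ by rw [h], fun h ↦ hinj h⟩

end Trichotomy

/-! ## §5 (APPEND, same seat g23) SIGN-FREE: which descents DIE in `Ш(E/K)` — exactly `0` and the capitulating class `s_y` (rank `E(K) = 1`) -/

section ShaSide

variable (W : WeierstrassCurve ℚ) [W.IsElliptic] [W.IsGloballyMinimal] (K : Type) [Field K] [NumberField K]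

omit [W.IsGloballyMinimal] in
/-- **THE Ш-SIDE OF THE TRICHOTOMY (SIGN-FREE).**  `W/ℚ` globally minimal with `ρ̄_{E,2}` onto, `K` imaginary quadratic, `rank E(K) = 1` (on the K₄ / K₄⁺
frames: `rank E(ℚ) = 0`, `rank E^{(d_K)}(ℚ) = 1`), `Q₀ ∈ E(K) ∖ 2E(K)` (e.g. `Q₀ = y_K/2^{M₀}`, §2), and `s_y ∈ H¹(ℚ, E[2])` with `res_K s_y = κ₂(Q₀)`.  Then for
EVERY `s ∈ H¹(ℚ, E[2])`: **`res_K s` dies in `H¹(K, E)` (i.e. in `Ш(E/K)` when `s` is Selmer) iff `s = 0` or `s = s_y`.**  Proof: a class killed by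
`H¹(K, E[2]) → H¹(K, E)` is a Kummer class `κ₂(R)`, `R ∈ E(K)` (exactness of the Kummer sequence, tree `mem_range_kummerMapTorsion_of_torsionH1ToH1_eq_zero`);
`E(K)/2E(K)` has `2^{rank}·#E(K)[2] = 2` elements (Mordell–Weil + `natCard_quotient_range_zsmul_eq_pow_mul_card_torsionBy`), namely `0` and the class of `Q₀`;
so `κ₂(R) ∈ {0, κ₂(Q₀)}`, and `res_K` is injective.  READING (K₄ / K₄⁺ cells, with p767174 §4 / p768636 §4): of the three non-zero classes `s_y, s′, s″` of
`Sel₂(E/ℚ) ≅ Ш(E/ℚ)[2]`, exactly `s_y` capitulates in `K`; a deep class `c₁(ℓ) = res_K s(ℓ)` with `s(ℓ) ∉ {0, s_y}` has NON-ZERO image `d(ℓ) ∈ Ш(E/K)[2]`, and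
`s′`, `s″ = s′ + s_y` have the SAME image.  UNCONDITIONAL given `rank E(K) = 1`.  BSD is NOT proved by this.
[cite: SilvermanAEC2009, VIII.§2, Thm. X.4.2] [cite: Kramer1981, Thm. 1] [cite: GrossLMS1991, §5 (5.1), §11] -/
theorem torsionH1ToH1_resTorsion_eq_zero_iff_of_rank_one (hs2 : W.HasSurjectiveModNGaloisRep 2) (hK : IsImaginaryQuadratic K)
    (hrk : (W.baseChange K).mordellWeilRank = 1)
    {Q₀ : (W.baseChange K).toAffine.Point} (hndiv : ¬ ∃ R : (W.baseChange K).toAffine.Point, (2 : ℤ) • R = Q₀)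
    {e : ℤ} (he : e = ((2 : ℕ) : ℤ))
    (hdiv : ∀ X : geomPoints (W.baseChange K), ∃ Y : geomPoints (W.baseChange K), e • Y = X)
    {sy : galH1Torsion W e} (hsy : resTorsion W K e sy = kummerMapTorsion (W.baseChange K) e hdiv Q₀) (s : galH1Torsion W e) :
    torsionH1ToH1 (W.baseChange K) e (resTorsion W K e s) = 0 ↔ s = 0 ∨ s = sy := by
  subst he
  have h2 : Module.finrank ℚ K = 2 := hK.1
  haveI : (W.baseChange K).IsElliptic := inferInstanceAs ((W.map (algebraMap ℚ K)).IsElliptic)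
  -- `res_K` is injective (`E(K)[2] = 0`)
  have hL := KFourPosCell.forall_two_smul_eq_zero_baseChange_of_kFourPos W K hs2 h2
  obtain ⟨θ, hθ, hc⟩ := Literature.NumberTheory.EllipticCurves.exists_sq_eq_discr_not_mem_range K h2
  have hinj := GenusExact.EigenClassesFinite.resTorsion_injective_of_noTorsion W K h2 hθ hc ((2 : ℕ) : ℤ) hL
  refine ⟨fun h0 ↦ ?_, ?_⟩
  · -- `res_K s = κ₂(R)`, `R ∈ E(K)`
    obtain ⟨R, hR⟩ := mem_range_kummerMapTorsion_of_torsionH1ToH1_eq_zero (W.baseChange K) ((2 : ℕ) : ℤ) hdiv _ h0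
    -- `E(K)/2E(K) = {0, [Q₀]}`
    haveI : Module.Finite ℤ (W.baseChange K).toAffine.Point := (W.baseChange K).module_finite_point_holds
    set N : AddSubgroup (W.baseChange K).toAffine.Point := (zsmulAddGroupHom (α := (W.baseChange K).toAffine.Point) ((2 : ℕ) : ℤ)).range
      with hN
    have hpt : Nat.card (AddSubgroup.torsionBy (W.baseChange K).toAffine.Point ((2 : ℕ) : ℤ)) = 1 := by
      have hbot : AddSubgroup.torsionBy (W.baseChange K).toAffine.Point ((2 : ℕ) : ℤ) = ⊥ :=
        (AddSubgroup.eq_bot_iff_forall _).mpr fun P hP ↦ hL P (by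
          rw [natCast_zsmul]; exact AddSubgroup.torsionBy.nsmul_iff.mp hP)
      rw [hbot, AddSubgroup.card_bot]
    have hcard : Nat.card ((W.baseChange K).toAffine.Point ⧸ N) = 2 := by
      have h := Literature.NumberTheory.EllipticCurves.natCard_quotient_range_zsmul_eq_pow_mul_card_torsionBy
        (A := (W.baseChange K).toAffine.Point) 2
      have hrk' : Module.finrank ℤ (W.baseChange K).toAffine.Point = 1 := hrk
      rw [hrk', pow_one, hpt, mul_one] at h
      exact h
    -- membership in `N = 2E(K)` kills the Kummer class
    have hker : ∀ {X : (W.baseChange K).toAffine.Point}, X ∈ N → kummerMapTorsion (W.baseChange K) ((2 : ℕ) : ℤ) hdiv X = 0 := by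
      intro X hX
      rw [← AddMonoidHom.mem_ker, kummerMapTorsion_ker]
      exact hX
    -- `[Q₀] ≠ 0` in `E(K)/2E(K)`
    have hQ₀N : ((Q₀ : (W.baseChange K).toAffine.Point) : (W.baseChange K).toAffine.Point ⧸ N) ≠ 0 := by
      intro h
      obtain ⟨R', hR'⟩ := (QuotientAddGroup.eq_zero_iff Q₀).mp h
      exact hndiv ⟨R', by simpa using hR'⟩
    -- the unique non-zero element of a group of order `2`
    obtain ⟨y, -, hyuniq⟩ := (Nat.card_eq_two_iff' (0 : (W.baseChange K).toAffine.Point ⧸ N)).mp hcard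
    have hQ₀y : ((Q₀ : (W.baseChange K).toAffine.Point) : (W.baseChange K).toAffine.Point ⧸ N) = y := hyuniq _ hQ₀N
    by_cases hRN : ((R : (W.baseChange K).toAffine.Point) : (W.baseChange K).toAffine.Point ⧸ N) = 0
    · -- `R ∈ 2E(K)`: `res_K s = 0`, so `s = 0`
      left
      apply hinj
      rw [map_zero, ← hR, hker ((QuotientAddGroup.eq_zero_iff R).mp hRN)]
    · -- `R ≡ Q₀ (mod 2E(K))`: `res_K s = κ₂(Q₀) = res_K s_y`, so `s = s_y`
      right
      have hRy : ((R : (W.baseChange K).toAffine.Point) : (W.baseChange K).toAffine.Point ⧸ N) = y := hyuniq _ hRN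
      have hRQ : R - Q₀ ∈ N := by
        rw [← QuotientAddGroup.eq_iff_sub_mem, hRy, hQ₀y]
      apply hinj
      rw [hsy, ← hR, ← sub_eq_zero, ← map_sub]
      exact hker hRQ
  · rintro (rfl | rfl)
    · rw [map_zero, map_zero]
    · rw [hsy, torsionH1ToH1_kummerMapTorsion]

end ShaSide

end Summit.BirchSwinnertonDyer.BirchSwinnertonDyer.Theorems.GenusSupplyNarrow.KFourCell

end
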